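import Summits.Ventures.PercRepro.C041RcPortGood

/-!
# THEOREM R, the rc reduction: validity, admissibility and the weight of the pattern of a source (p6, gen 24)

Setting of `C041RcPortGood`.  For a configuration `S` agreeing with `O` on the bare edges:

* `rc_conn_of_X₁` / `rc_conn_of_X₂` / `rc_X_of_conn` / **`rc_red_iff_X`** — with a red edge between the terminals,
  `c` is red-joined to both terminals iff some port vertex carries a red terminal edge (`X₁ ∨ X₂`): the validity
  dictionary (red type `D` ⟺ `V_∨`);
* **`rc_adm`** — the pattern of a configuration of the rc family with the probe outside both blue clusters and no
  doubly attached zone is admissible (a non-switchable port zone is a singleton whose vertex would be switchable if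
  it carried a blue edge; a zone with a blue 1-edge and a blue 2-edge is doubly attached);
* **`rc_weight`** — the weight of the pattern is the Good-degree weight `3·[Good_a S] + 3·[Good_b S] − 2`.
-/

namespace PercRepro

namespace MultiGraph

open Finset ZonePort

variable {V E : Type*} {G : MultiGraph V E}

section Valid

variable [Fintype V] {a b c : V} {O S : Config E} (hca : c ≠ a) (hcb : c ≠ b)
  (hc : ∀ e, ¬ G.Joins e c a ∧ ¬ G.Joins e c b) (hne : a ≠ b)

omit [Fintype V] in
/-- The red bare cluster of `c` depends on the bare edges only. -/
theorem rc_bareReach_congr (hagree : G.AgreeBare a b O S) : G.BareReach a b c O = G.BareReach a b c S := by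
  unfold BareReach
  rw [rc_bareAdj_O_eq hagree]

include hca hcb hc hne

/-- **A red 1-edge at a port vertex joins `c` to `a`.** -/
theorem rc_conn_of_X₁ (hagree : G.AgreeBare a b O S)
    (hx : (G.rcPort a b c O hca hcb hc).X₁ (rcPattern hca hcb hc S)) : G.Conn S c a := by
  obtain ⟨t, hts, hxt⟩ := hx
  have hj : G.Joins t.1.1 (G.tvOf a b t.1.1) a := (ts_false_iff hca hcb hc hne t.1).1 hts
  have hK : G.tvOf a b t.1.1 ∈ G.BareReach a b c S := by
    rw [← rc_bareReach_congr hagree]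
    exact tvOf_mem_bareReach a b c O hca hcb t.1
  exact (conn_of_bareReach hK).trans (Conn.of_openAdj ⟨t.1.1, hxt, hj⟩)

/-- **A red 2-edge at a port vertex joins `c` to `b`.** -/
theorem rc_conn_of_X₂ (hagree : G.AgreeBare a b O S)
    (hx : (G.rcPort a b c O hca hcb hc).X₂ (rcPattern hca hcb hc S)) : G.Conn S c b := by
  obtain ⟨t, hts, hxt⟩ := hx
  have hj : G.Joins t.1.1 (G.tvOf a b t.1.1) b := (ts_true_iff hca hcb hc hne t.1).1 hts
  have hK : G.tvOf a b t.1.1 ∈ G.BareReach a b c S := by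
    rw [← rc_bareReach_congr hagree]
    exact tvOf_mem_bareReach a b c O hca hcb t.1
  exact (conn_of_bareReach hK).trans (Conn.of_openAdj ⟨t.1.1, hxt, hj⟩)

/-- **A red connection from `c` to a terminal gives a red terminal edge at a port vertex**: cut the walk at its
first terminal. -/
theorem rc_X_of_conn (hagree : G.AgreeBare a b O S) (h : G.Conn S c a ∨ G.Conn S c b) :
    (G.rcPort a b c O hca hcb hc).X₁ (rcPattern hca hcb hc S) ∨
      (G.rcPort a b c O hca hcb hc).X₂ (rcPattern hca hcb hc S) := by
  have hfirst : ∃ t ∈ ({a, b} : Set V),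
      Relation.ReflTransGen (fun x y => G.OpenAdj S x y ∧ x ∉ ({a, b} : Set V)) c t := by
    rcases h with h | h
    · exact exists_first_mem_of_conn h (by simp)
    · exact exists_first_mem_of_conn h (by simp)
  obtain ⟨t, ht, hwalk⟩ := hfirst
  have hct : c ≠ t := by
    rintro rfl
    simp only [Set.mem_insert_iff, Set.mem_singleton_iff] at ht
    rcases ht with h | h
    · exact hca h
    · exact hcb h
  obtain ⟨w, ⟨hwt, hwY⟩, hcw⟩ := exists_last_step hwalk hct
  -- the prefix is a red bare walk
  have key : ∀ v, Relation.ReflTransGen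
      (fun x y => (G.OpenAdj S x y ∧ x ∉ ({a, b} : Set V)) ∧ y ≠ t) c v →
      v ∉ ({a, b} : Set V) → v ∈ G.BareReach a b c S := by
    intro v hv
    induction hv with
    | refl => intro _; exact Relation.ReflTransGen.refl
    | @tail x y hcx hxy ih =>
      intro hy
      have hx : x ∉ ({a, b} : Set V) := hxy.1.2
      have hx' : x ≠ a ∧ x ≠ b := by
        simp only [Set.mem_insert_iff, Set.mem_singleton_iff, not_or] at hx
        exact hx
      have hy' : y ≠ a ∧ y ≠ b := by
        simp only [Set.mem_insert_iff, Set.mem_singleton_iff, not_or] at hy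
        exact hy
      exact (ih hx).tail (bareAdj_of_openAdj hxy.1.1 hx' hy')
  have hwK : w ∈ G.BareReach a b c O := by
    rw [rc_bareReach_congr hagree]
    exact key w hcw hwY
  obtain ⟨e, hSe, hje⟩ := hwt
  simp only [Set.mem_insert_iff, Set.mem_singleton_iff] at ht
  rcases ht with rfl | rfl
  · -- `t = a`
    have hje' : G.Joins e w t := hje
    have hpv : G.IsPortVert t b c O w := ⟨hwK, e, Or.inl hje'⟩
    have htv : G.tvOf t b e = w := tvOf_eq_of_portVert t b c O hca hcb hpv (Or.inl hje')
    left
    refine ⟨toTerm hca hcb hc ⟨e, w, hpv, Or.inl hje'⟩, ?_, hSe⟩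
    rw [ts_false_iff hca hcb hc hne]
    show G.Joins e (G.tvOf t b e) t
    rw [htv]
    exact hje'
  · -- `t = b`
    have hje' : G.Joins e w t := hje
    have hpv : G.IsPortVert a t c O w := ⟨hwK, e, Or.inr hje'⟩
    have htv : G.tvOf a t e = w := tvOf_eq_of_portVert a t c O hca hcb hpv (Or.inr hje')
    right
    refine ⟨toTerm hca hcb hc ⟨e, w, hpv, Or.inr hje'⟩, ?_, hSe⟩
    rw [ts_true_iff hca hcb hc hne]
    show G.Joins e (G.tvOf a t e) t
    rw [htv]
    exact hje'

/-- **The validity dictionary**: with a red edge between the terminals, `c` is red-joined to both terminals iff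
some port vertex carries a red terminal edge (`X₁ ∨ X₂`). -/
theorem rc_red_iff_X (hagree : G.AgreeBare a b O S) (hab : ∃ e, G.Joins e a b ∧ S e = true) :
    (G.Conn S c a ∧ G.Conn S c b) ↔
      ((G.rcPort a b c O hca hcb hc).X₁ (rcPattern hca hcb hc S) ∨
        (G.rcPort a b c O hca hcb hc).X₂ (rcPattern hca hcb hc S)) := by
  obtain ⟨e, hje, hSe⟩ := hab
  have hab' : G.Conn S a b := Conn.of_openAdj ⟨e, hSe, hje⟩
  constructor
  · intro h
    exact rc_X_of_conn hca hcb hc hne hagree (Or.inl h.1)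
  · rintro (h | h)
    · have := rc_conn_of_X₁ hca hcb hc hne hagree h
      exact ⟨this, this.trans hab'⟩
    · have := rc_conn_of_X₂ hca hcb hc hne hagree h
      exact ⟨this.trans hab'.symm, this⟩

omit hca hcb hc hne in
/-- A port vertex with a blue terminal edge is switchable (in the rc family, with the probe outside both blue
clusters). -/
theorem switchable_of_blue (hagree : G.AgreeBare a b O S) (hrc : G.RcAttach a b O S)
    (hcA : c ∉ G.cluster Sᶜ a) (hcB : c ∉ G.cluster Sᶜ b) {u : V} (hu : G.BlueTo a S u ∨ G.BlueTo b S u) :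
    G.Switchable a b c O u := by
  refine ⟨hrc u hu, fun hcu => ?_⟩
  rcases hu with hu | hu
  · exact hcA (mem_cluster_compl_a_of_blueBareConn hagree hu hcu.symm)
  · exact hcB (mem_cluster_compl_b_of_blueBareConn hagree hu hcu.symm)

/-- **The pattern of a configuration of the rc family is admissible.** -/
theorem rc_adm (hagree : G.AgreeBare a b O S) (hrc : G.RcAttach a b O S) (hnd : G.NoDoubleZone a b O S)
    (hcA : c ∉ G.cluster Sᶜ a) (hcB : c ∉ G.cluster Sᶜ b) :
    (G.rcPort a b c O hca hcb hc).Adm (rcPattern hca hcb hc S) := by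
  refine ⟨fun t hsw => ?_, fun t f htf hts hfs => ?_⟩
  · -- a non-switchable zone: its vertex carries no blue edge
    by_contra hxt
    have hxt' : S t.1.1 = false := by
      cases h : S t.1.1
      · rfl
      · exact absurd h hxt
    obtain ⟨_, hj⟩ := portVert_tvOf a b c O hca hcb t.1
    have hblue : G.BlueTo a S (G.tvOf a b t.1.1) ∨ G.BlueTo b S (G.tvOf a b t.1.1) := by
      rcases hj with hj | hj
      · exact Or.inl ⟨t.1.1, hj, hxt'⟩
      · exact Or.inr ⟨t.1.1, hj, hxt'⟩
    have hs : (G.rcPort a b c O hca hcb hc).sw ((G.rcPort a b c O hca hcb hc).tz t.1) = true := by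
      rw [sw_true_iff, rcPort_tz]
      exact ⟨_, self_mem_portZone a b c O _, switchable_of_blue hagree hrc hcA hcB hblue⟩
    rw [hsw] at hs
    exact Bool.noConfusion hs
  · -- a zone with a blue 1-edge and a blue 2-edge is doubly attached
    by_contra hboth
    push Not at hboth
    have hxt : S t.1.1 = false := by
      cases h : S t.1.1
      · rfl
      · exact absurd h hboth.1
    have hxf : S f.1.1 = false := by
      cases h : S f.1.1
      · rfl
      · exact absurd h hboth.2
    have hjt : G.Joins t.1.1 (G.tvOf a b t.1.1) a := (ts_false_iff hca hcb hc hne t.1).1 hts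
    have hjf : G.Joins f.1.1 (G.tvOf a b f.1.1) b := (ts_true_iff hca hcb hc hne f.1).1 hfs
    apply hnd (G.tvOf a b t.1.1) (G.tvOf a b f.1.1) _ ⟨⟨t.1.1, hjt, hxt⟩, ⟨f.1.1, hjf, hxf⟩⟩
    rw [rcPort_tz, rcPort_tz] at htf
    have hmem : G.tvOf a b f.1.1 ∈ G.portZone a b c O (G.tvOf a b t.1.1) := by
      rw [htf]
      exact self_mem_portZone a b c O _
    exact (mem_zone a b O).1 (portZone_subset_zone a b c O _ hmem)

open Classical in
/-- **The weight of the pattern is the Good-degree weight of the configuration.** -/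
theorem rc_weight (hagree : G.AgreeBare a b O S) (hab : ∀ e, G.Joins e a b → S e = true)
    (hnd : G.NoDoubleZone a b O S) (hrc : G.RcAttach a b O S) (hcA : c ∉ G.cluster Sᶜ a)
    (hcB : c ∉ G.cluster Sᶜ b) :
    (G.rcPort a b c O hca hcb hc).weight (rcPattern hca hcb hc S) =
      (if G.WalkAvoiding S (G.cluster Sᶜ a) c b then 3 else 0) +
        (if G.WalkAvoiding S (G.cluster Sᶜ b) c a then 3 else 0) - 2 := by
  unfold ZonePort.Problem.weight
  rw [if_congr (rc_good_a_iff hca hcb hc hne hagree hab hnd hrc hcA).symm rfl rfl,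
    if_congr (rc_good_b_iff hca hcb hc hne hagree hab hnd hrc hcB).symm rfl rfl]

end Valid

end MultiGraph

end PercRepro
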